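import Summits.BirchSwinnertonDyer.BirchSwinnertonDyer.Theses.SchneiderFreeAdditiveX3
import Summits.BirchSwinnertonDyer.BirchSwinnertonDyer.Theorems.SchneiderFreeAdditiveX3PotMultBranchIMCReductions
import Summits.BirchSwinnertonDyer.BirchSwinnertonDyer.Theorems.SchneiderFreeAdditiveX3StepLManinLinkOfKolyvagin
import HarnessLib

/-!
# Route `SchneiderFreeAdditiveX3` (rung K1 door), crux `PotMultBranchIMC` (item stmt-BirchSwinnertonDyer-19176):
# modulo Kolyvagin and crux r4, the crux IS the (M) half of the route's target `StepLManin`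

Cell `bsd-schneider-ideate`, seat `bsd-schneider-door-c2` (prover, generation 2). HONEST FRAMING:
arithmetic bookkeeping on the route's own sockets; NOTHING is asserted about elliptic curves; the crux
`PotMultBranchIMC` and the control crux `AnticycControlAdditive` stay OPEN; BSD is not advanced by this
file; it is `--supports` material for item 19176 (what the tribunal's «C versus S» question needs, in
kernel form).

Door-c2 g0 proved (`SchneiderFreeAdditiveX3StepLManinLinkOfKolyvagin.lean`,
`additiveStepLInputManinAt_of_kolyvagin_of_potMult_of_control`): Kolyvagin + `PotMultBranchIMC` +
`AnticycControlAdditive` ⟹ the target's socket `AdditiveStepLInputManinAt W p` on every pair of the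
potentially multiplicative reducible cell (M). This file proves the CONVERSE and packages the
equivalence:

* `index_le_primary_of_indexLowerBoundLeAt_of_shaFinite` (pointwise, every `p`): at a classical
  Heegner field `K` for `N_E`, the target's display `IndexLowerBoundLeAt W p K P s`
  (`2·ord_p[E(K):ℤP] ≤ ord_p #Ш(E/K) + 2·ord_p ∏_ℓ c_ℓ(E) + 2s`, `#Ш(E/K) = shaOrder`, junk `0` when
  infinite) gives, for FINITE `Ш(E/K)`, the frames' currency
  `2·ord_p[E(K):ℤP] ≤ ord_p #Ш(E/K)[p^∞] + ord_p ∏_{w∣N⁺} c_w(E/K) + 2s` (`#Ш[p^∞] = p^{ord_p #Ш}`;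
  Tamagawa transport `ord_p ∏_{w∣N⁺} c_w(E/K) = ord_p ∏_w c_w(E/K) = 2·ord_p ∏_ℓ c_ℓ(E)` at a Heegner
  field, every `p`) — the converse reading of g0's `indexLowerBoundLeAt_of_frames_of_shaFinite`.
* `potMultBranchIMC_of_kolyvagin_of_control_of_stepL_subM`: Kolyvagin (`kolyvagin`, a conjunct of the
  route's `PrintedFacts`: a non-torsion Heegner point makes `Ш(E/K)` finite) + crux r4 + the (M) half of
  the target ⟹ `PotMultBranchIMC` BY NAME (g0's converse bookkeeping
  `additiveIMCLowerBDPOnTreeLeAt_of_control_of_index_le` at every frame).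
* `potMultBranchIMC_iff_stepL_subM_of_kolyvagin_of_control`: modulo Kolyvagin and crux r4,
  `PotMultBranchIMC ↔ ∀ pairs on (M), AdditiveStepLInputManinAt W p`. The decomposition of the door at
  (M) neither loses nor gains strength: crux r2 is EXACTLY what the target needs on (M).

References: Jetchev–Skinner–Wan, Camb. J. Math. 5 (2017) §7.3.1 (eq:tamK), §7.4.1 (eq:shalowerK-1)
(arXiv:1512.06894 p. 30); Gross 1991 Thm. 1.3 (Kolyvagin).
-/

noncomputable section

open scoped Classical

open WeierstrassCurve NumberField IsDedekindDomain Field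
  Literature.NumberTheory.EllipticCurves
  Literature.NumberTheory.EllipticCurves.ModularForms
  Literature.NumberTheory.EllipticCurves.GreenbergSelmer
  Literature.NumberTheory.EllipticCurves.Rank1Residual
  Literature.NumberTheory.EllipticCurves.Rank1Residual.Typed
  Summit.BirchSwinnertonDyer.Rank1Residual
  Summit.BirchSwinnertonDyer.Rank1Residual.X11b
  Summit.BirchSwinnertonDyer.Rank1Residual.X11b.AcSelmer
  Summit.BirchSwinnertonDyer.Rank1Residual.X11b.Halves
  Summit.BirchSwinnertonDyer.BirchSwinnertonDyer.Theses.SchneiderFreeAdditiveX3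

-- D-0017 layout: summit = sub-problem, so `Summit.BirchSwinnertonDyer.BirchSwinnertonDyer.…` is the
-- mandated namespace (same option as the route's sockets files).
set_option linter.dupNamespace false
set_option autoImplicit false

namespace Summit.BirchSwinnertonDyer.BirchSwinnertonDyer.Theorems.SchneiderFree

section TargetCurrency

variable {p : ℕ} [Fact p.Prime] {K : Type} [Field K] [NumberField K]
  {W : WeierstrassCurve ℚ} [W.IsElliptic]

/-- **From the target's currency back to the frames' currency, given `Ш(E/K)` finite.** At a
classical Heegner field `K` for `N_E` (every prime `p`), the target's display
`IndexLowerBoundLeAt W p K P s` (`2·ord_p[E(K):ℤP] ≤ ord_p #Ш(E/K) + 2·ord_p ∏_ℓ c_ℓ(E) + 2s`, with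
`#Ш(E/K) = shaOrder`) gives, for FINITE `Ш(E/K)`, the frame-free inequality in the cruxes' currency
`2·ord_p[E(K):ℤP] ≤ ord_p #Ш(E/K)[p^∞] + ord_p ∏_{w∣N⁺} c_w(E/K) + 2s` — by
`ord_p #Ш(E/K)[p^∞] = ord_p #Ш(E/K)` and the Tamagawa transport `ord_p ∏_{w∣N⁺} c_w(E/K) =
2·ord_p ∏_ℓ c_ℓ(E)` (every `p`). The converse reading of door-c2 g0's
`indexLowerBoundLeAt_of_frames_of_shaFinite`. [cite: JetchevSkinnerWan2017, §7.3.1 (eq:tamK) and §7.4.1 (arXiv:1512.06894 p. 30)] -/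
theorem index_le_primary_of_indexLowerBoundLeAt_of_shaFinite {N : ℕ}
    {P : (W.baseChange K).toAffine.Point} {s : ℕ}
    (hN : W.conductorNorm ℤ = N) (hK : IsImaginaryQuadratic K)
    (hHe : SatisfiesHeegnerHypothesis N K) (hfin : (W.baseChange K).ShaFinite)
    (hI : IndexLowerBoundLeAt W p K P s) :
    2 * (padicValNat p (AddSubgroup.zmultiples P).index : ℤ) ≤
      (padicValNat p (Nat.card (AddCommGroup.primaryComponent (W.baseChange K).sha p)) : ℤ) +
        padicValNat p (X11b.tamagawaProductSplit W K) + 2 * (s : ℤ) := by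
  have htam1 := X11b.padicValNat_tamagawaProductSplit_eq_of_heegner_prime W K p hN hHe
  have htam2 := X11b.padicValNat_tamagawaProduct_baseChange_of_heegner_prime W K p hK hN hHe
  haveI : Finite (W.baseChange K).sha := hfin
  have hsha : padicValNat p (Nat.card (AddCommGroup.primaryComponent (W.baseChange K).sha p)) =
      padicValNat p (W.baseChange K).shaOrder := by
    rw [Literature.NumberTheory.EllipticCurves.natCard_primaryComponent_eq_pow_padicValNat p,
      padicValNat.prime_pow]
    rfl
  unfold IndexLowerBoundLeAt at hI
  rw [htam1, htam2, hsha]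
  omega

end TargetCurrency

/-- **`PotMultBranchIMC` (BY NAME) ⇐ Kolyvagin + crux r4 + the (M) half of the TARGET.** If STEP L,
Manin-robust (`AdditiveStepLInputManinAt W p`, the target `StepLManin`'s socket) holds for every pair
on the potentially multiplicative reducible cell, then — Kolyvagin's finiteness of `Ш(E/K)` turning
the target's currency into the frames' currency (`index_le_primary_of_indexLowerBoundLeAt_of_shaFinite`)
and the control crux turning the frame-free inequality into the socket at every frame (door-c2 g0's
`additiveIMCLowerBDPOnTreeLeAt_of_control_of_index_le`) — the crux holds. CONDITIONAL on the three
hypotheses (the first printed, the other two open).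
[cite: JetchevSkinnerWan2017, §7.4.1 (arXiv:1512.06894 p. 30)] [cite: Gross1991, Thm. 1.3] -/
theorem potMultBranchIMC_of_kolyvagin_of_control_of_stepL_subM
    (hKo : ∀ (N : ℕ) [NeZero N] (W : WeierstrassCurve ℚ) (K : Type) [Field K] [NumberField K],
      Literature.NumberTheory.EllipticCurves.kolyvagin N W K)
    (h4 : Theses.SchneiderFreeAdditiveX3.AnticycControlAdditive)
    (hL : ∀ (W : WeierstrassCurve ℚ) [W.IsElliptic] [W.IsGloballyMinimal] (p : ℕ) [Fact p.Prime],
      W.analyticRank = 1 → p ≠ 2 → ClassX3 W p → Additive.SubM W p →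
        AdditiveStepLInputManinAt W p) :
    Theses.SchneiderFreeAdditiveX3.PotMultBranchIMC := by
  intro W _ _ p _ hr hp2 hX hS N _ K _ _ Dt H ι P hr' hloc hN hK hodd hunit hHe hLd hP hnt κ hκ γ _ 𝔭
    h𝔭 he hf
  have hS' : Additive.SubSemistableTwist W p := Or.inl hS
  have hfin : (W.baseChange K).ShaFinite := (hKo N W K hK hHe ⟨Dt, H, ι, hP⟩ hnt).2
  have hI : IndexLowerBoundLeAt W p K P (padicValNat p Dt.c.natAbs) :=
    hL W p hr hp2 hX hS N K Dt H ι P hr' hloc hN hK hodd hunit hHe hLd hP hnt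
  exact additiveIMCLowerBDPOnTreeLeAt_of_control_of_index_le
    (h4 W p hr hp2 hX hS' N K Dt H ι P hr' hloc hN hK hodd hunit hHe hLd hP hnt κ hκ γ 𝔭 h𝔭 he hf)
    (index_le_primary_of_indexLowerBoundLeAt_of_shaFinite hN hK hHe hfin hI)

/-- **Modulo Kolyvagin and crux r4, crux r2 ⟺ the (M) half of the target** (in the route's own
predicates): `PotMultBranchIMC ↔ ∀ pairs on (M), AdditiveStepLInputManinAt W p`. Forward: door-c2 g0's
`additiveStepLInputManinAt_of_kolyvagin_of_potMult_of_control`; backward: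
`potMultBranchIMC_of_kolyvagin_of_control_of_stepL_subM`. So the decomposition of the door at (M)
neither loses nor gains strength: the crux is EXACTLY what the target needs there. CONDITIONAL on
Kolyvagin (printed) and on crux r4 (open). [cite: JetchevSkinnerWan2017, §7.4.1 (arXiv:1512.06894 p. 30)] -/
theorem potMultBranchIMC_iff_stepL_subM_of_kolyvagin_of_control
    (hKo : ∀ (N : ℕ) [NeZero N] (W : WeierstrassCurve ℚ) (K : Type) [Field K] [NumberField K],
      Literature.NumberTheory.EllipticCurves.kolyvagin N W K)
    (h4 : Theses.SchneiderFreeAdditiveX3.AnticycControlAdditive) :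
    Theses.SchneiderFreeAdditiveX3.PotMultBranchIMC ↔
      ∀ (W : WeierstrassCurve ℚ) [W.IsElliptic] [W.IsGloballyMinimal] (p : ℕ) [Fact p.Prime],
        W.analyticRank = 1 → p ≠ 2 → ClassX3 W p → Additive.SubM W p →
          AdditiveStepLInputManinAt W p :=
  ⟨fun h2 ↦ additiveStepLInputManinAt_of_kolyvagin_of_potMult_of_control hKo h2 h4,
    fun hL ↦ potMultBranchIMC_of_kolyvagin_of_control_of_stepL_subM hKo h4 hL⟩

end Summit.BirchSwinnertonDyer.BirchSwinnertonDyer.Theorems.SchneiderFree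

end
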